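import Mathlib
import Summits.ABC.ABC.Statement
import HarnessLib

/-!
# Square factors of `2^k ∓ 1` at non-Wieferich primes (solo-blind seat, session 5)

Shapes E (`1 + 2^k = p^m q^n`) and F (`1 + p^m q^n = 2^k`) of the first open support satisfy `c > rad` exactly when
`2^k ± 1` is squareful.  We prove the classical criterion behind the "Wieferich-type residue" of the ω = 3 atlas:
if `p² ∣ 2^k - 1` (or `p² ∣ 2^k + 1`) for an odd prime `p` that is NOT a base-2 Wieferich prime
(`p² ∤ 2^(p-1) - 1`), then `p ∣ k`.  (Order argument in `ZMod (p²)`: the order of `2` divides `gcd(k, p(p-1))`, and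
if `p ∤ k` it divides `p - 1`.)  Hence a square factor of `2^k ∓ 1` comes either from lifting the exponent (`p ∣ k`)
or from a Wieferich prime.

* `dvd_of_sq_dvd_two_pow_sub_one`, `dvd_of_sq_dvd_two_pow_add_one` : the criterion.
* `shapeF_square_factor`, `shapeE_square_factor` : the shape-E/F corollaries.
-/

namespace Summit.ABC.ABC.Theorems

/-- `(2 : ZMod N)^j = 1 ↔ N ∣ 2^j - 1`. -/
private theorem two_pow_eq_one_iff {N j : ℕ} : (2 : ZMod N) ^ j = 1 ↔ N ∣ 2 ^ j - 1 := by
  rw [← ZMod.natCast_eq_zero_iff, Nat.cast_sub Nat.one_le_two_pow, Nat.cast_pow, Nat.cast_ofNat, Nat.cast_one,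
    sub_eq_zero]

/-- **Non-Wieferich square factors of `2^k - 1` lift from the exponent.** If `p` is an odd prime with
`p² ∣ 2^k - 1` and `p² ∤ 2^(p-1) - 1`, then `p ∣ k`. -/
theorem dvd_of_sq_dvd_two_pow_sub_one {p k : ℕ} (hp : p.Prime) (hp2 : p ≠ 2) (h : p ^ 2 ∣ 2 ^ k - 1)
    (hW : ¬ p ^ 2 ∣ 2 ^ (p - 1) - 1) : p ∣ k := by
  have hp3 : 3 ≤ p := by have := hp.two_le; omega
  have hN1 : 1 < p ^ 2 := by nlinarith
  set x : ZMod (p ^ 2) := 2 with hx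
  have hxk : x ^ k = 1 := two_pow_eq_one_iff.mpr h
  -- Euler: `x^(p(p-1)) = 1`
  have hcop : Nat.Coprime 2 (p ^ 2) :=
    Nat.Coprime.pow_right 2 ((Nat.coprime_primes Nat.prime_two hp).mpr hp2.symm)
  have hE' : 2 ^ Nat.totient (p ^ 2) % p ^ 2 = 1 := Nat.pow_totient_mod_eq_one hN1 hcop
  have htot : Nat.totient (p ^ 2) = p * (p - 1) := by
    rw [Nat.totient_prime_pow hp (by norm_num)]
    simp
  have hE : x ^ (p * (p - 1)) = 1 := by
    rw [← htot]
    apply two_pow_eq_one_iff.mpr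
    have hmod : 1 ≡ 2 ^ Nat.totient (p ^ 2) [MOD p ^ 2] := by
      unfold Nat.ModEq
      rw [hE', Nat.mod_eq_of_lt hN1]
    exact (Nat.modEq_iff_dvd' Nat.one_le_two_pow).mp hmod
  by_contra hpk
  set g := Nat.gcd k (p * (p - 1)) with hg
  have hxg : x ^ g = 1 := pow_gcd_eq_one.mpr ⟨hxk, hE⟩
  have hpg : ¬ p ∣ g := fun h' => hpk (h'.trans (Nat.gcd_dvd_left _ _))
  have hcopg : Nat.Coprime g p := Nat.coprime_comm.mp ((Nat.Prime.coprime_iff_not_dvd hp).mpr hpg)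
  have hg1 : g ∣ p * (p - 1) := Nat.gcd_dvd_right _ _
  obtain ⟨c, hc⟩ : g ∣ p - 1 := hcopg.dvd_of_dvd_mul_left hg1
  have : x ^ (p - 1) = 1 := by rw [hc, pow_mul, hxg, one_pow]
  exact hW (two_pow_eq_one_iff.mp this)

/-- The same for `2^k + 1`: if `p` is an odd prime with `p² ∣ 2^k + 1` and `p² ∤ 2^(p-1) - 1`, then `p ∣ k`. -/
theorem dvd_of_sq_dvd_two_pow_add_one {p k : ℕ} (hp : p.Prime) (hp2 : p ≠ 2) (h : p ^ 2 ∣ 2 ^ k + 1)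
    (hW : ¬ p ^ 2 ∣ 2 ^ (p - 1) - 1) : p ∣ k := by
  have h2 : p ^ 2 ∣ 2 ^ (2 * k) - 1 := by
    have : 2 ^ (2 * k) - 1 = (2 ^ k - 1) * (2 ^ k + 1) := by
      have h1 : 1 ≤ 2 ^ k := Nat.one_le_two_pow
      have h3 : 1 ≤ 2 ^ (2 * k) := Nat.one_le_two_pow
      zify [h1, h3]
      ring
    rw [this]
    exact h.mul_left _
  rcases (Nat.Prime.dvd_mul hp).mp (dvd_of_sq_dvd_two_pow_sub_one hp hp2 h2 hW) with h' | h'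
  · exact absurd ((Nat.prime_dvd_prime_iff_eq hp Nat.prime_two).mp h') hp2
  · exact h'

/-- **Shape F.** If `2^k - 1 = p^m q^n` with `p` an odd non-Wieferich prime and `m ≥ 2`, then `p ∣ k`. -/
theorem shapeF_square_factor {k m n p q : ℕ} (hp : p.Prime) (hp2 : p ≠ 2) (hm : 2 ≤ m)
    (hW : ¬ p ^ 2 ∣ 2 ^ (p - 1) - 1) (h : 2 ^ k - 1 = p ^ m * q ^ n) : p ∣ k :=
  dvd_of_sq_dvd_two_pow_sub_one hp hp2 (by rw [h]; exact (pow_dvd_pow p hm).mul_right _) hW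

/-- **Shape E.** If `2^k + 1 = p^m q^n` with `p` an odd non-Wieferich prime and `m ≥ 2`, then `p ∣ k`. -/
theorem shapeE_square_factor {k m n p q : ℕ} (hp : p.Prime) (hp2 : p ≠ 2) (hm : 2 ≤ m)
    (hW : ¬ p ^ 2 ∣ 2 ^ (p - 1) - 1) (h : 2 ^ k + 1 = p ^ m * q ^ n) : p ∣ k :=
  dvd_of_sq_dvd_two_pow_add_one hp hp2 (by rw [h]; exact (pow_dvd_pow p hm).mul_right _) hW

end Summit.ABC.ABC.Theorems
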